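import Summits.NavierStokesRegularity.FunctionalMining.Candidates
import HarnessLib

/-!
# FunctionalMining — Theorem H (the heat sieve) for the saturating law `T_LD`, kernel form

Search for candidate a priori estimates; no regularity claim. Cell `pub-nsfunc`, prove seat
(gen 10). SIEVELD §0 (Lemma 0) and §1 (Theorem H, N13) of the no-go seat, as kernel statements about
the cell's census template: if a functional `F` obeys the saturating law
`dF/dt ≤ κ ν^{−γ} (2ℰ) F^{1+1/σ}` (`Candidates.SaturatingLaw`) along EVERY zero-mean classical solution
of unforced Navier–Stokes on `T³` for EVERY `ν > 0`, and `F` has initial rates `(N, V)`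
(`HasInitialRate F N V`: the one-sided derivative of `s ↦ F(u s)` at the initial time is
`N(u₀) + ν V(u₀)` — `N` the inertial/Euler production, `V` the viscous production = the derivative
along the HEAT flow), then at every smooth divergence-free zero-mean datum `u₀`:

* (Lemma 0, static reduction — tree `initialRate_le_of_isRateBudget`) `N u₀ + ν V u₀ ≤ κ ν^{−γ} (2ℰ u₀) (F u₀)^{1+1/σ}`
  for every `ν > 0`;
* (**Theorem H**, `SaturatingLaw.viscousRate_nonpos`) if `γ ≥ 0` then `V u₀ ≤ 0`: letting
  `ν → ∞` the left side grows linearly while the right side stays bounded;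
* (`not_saturatingLaw_of_viscousRate_pos`) hence ONE datum with `V u₀ > 0` kills the row for every
  `κ` — "the heat sieve": functionals that can grow under pure diffusion obey no saturating law.

The sieve decides the pressure-moment rows `EP.*|T_LD|G1` (SIEVELD §2, witness W11: the
reciprocal crossed shear, a steady Euler flow whose pressure moments grow under the heat flow) and
is passed (`V ≤ 0` by Jensen) by every convex core of a linear operator commuting with the heat
semigroup (`|ω|^q`, `|S|^q`, `|u|^s`, `Ḣ^s`, …); the witnesses themselves are not in this file.
-/

noncomputable section

open MeasureTheory Set Filter Topology

namespace Summit.NavierStokesRegularity.FunctionalMining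

open Literature.Analysis.FunctionSpaces Literature.Analysis.FluidPDE

variable {d : Type*} [Fintype d] [DecidableEq d]

/-- **Lemma 0 for the saturating law (static reduction at a datum).** If `F` obeys
`SaturatingLaw F σ γ κ` and has initial rates `(N, V)`, then at every smooth divergence-free
zero-mean datum `u₀` on `T³` and every `ν > 0`:
`N u₀ + ν V u₀ ≤ κ ν^{−γ} (2ℰ u₀) (F u₀)^{1+1/σ}` (solve from `u₀`, `Torus.exists_classicalNS_smooth`,
and compare the one-sided derivatives at `t = 0`). [ours; SIEVELD §0 Lemma 0] -/
theorem SaturatingLaw.initialRate_le {F : (UnitAddTorus d → EuclideanSpace ℝ d) → ℝ}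
    {N V : (UnitAddTorus d → EuclideanSpace ℝ d) → ℝ} {σ γ κ : ℝ}
    (hF : SaturatingLaw (d := d) F σ γ κ) (hNV : HasInitialRate F N V) (hd : Fintype.card d = 3)
    {ν : ℝ} (hν : 0 < ν) {u₀ : UnitAddTorus d → EuclideanSpace ℝ d} (hu₀ : Torus.IsSmooth u₀)
    (hdiv : Torus.IsDivFree u₀) (hmean : Torus.HasZeroMean u₀) :
    N u₀ + ν * V u₀ ≤ κ * ν ^ (-γ) * (2 * torusEnstrophy u₀) * F u₀ ^ (1 + σ⁻¹) :=
  initialRate_le_of_isRateBudget hF hNV hd hν hu₀ hdiv hmean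

/-- **Theorem H (heat sieve), kernel form.** If `F` obeys the saturating law
`SaturatingLaw F σ γ κ` with `γ ≥ 0` and has initial rates `(N, V)`, then the viscous (heat-flow)
rate is non-positive at every smooth divergence-free zero-mean datum on `T³`: `V u₀ ≤ 0`
(for `ν ≥ 1`, `ν^{−γ} ≤ 1`, so the budget is bounded while `N u₀ + ν V u₀ → +∞` if `V u₀ > 0`).
[ours; SIEVELD §1 Theorem H (N13)] -/
theorem SaturatingLaw.viscousRate_nonpos {F : (UnitAddTorus d → EuclideanSpace ℝ d) → ℝ}
    {N V : (UnitAddTorus d → EuclideanSpace ℝ d) → ℝ} {σ γ κ : ℝ}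
    (hF : SaturatingLaw (d := d) F σ γ κ) (hNV : HasInitialRate F N V) (hd : Fintype.card d = 3)
    (hγ : 0 ≤ γ) {u₀ : UnitAddTorus d → EuclideanSpace ℝ d} (hu₀ : Torus.IsSmooth u₀)
    (hdiv : Torus.IsDivFree u₀) (hmean : Torus.HasZeroMean u₀) : V u₀ ≤ 0 := by
  by_contra hV
  rw [not_le] at hV
  -- the `ν`-independent bound of the budget for `ν ≥ 1`
  obtain ⟨X, hX⟩ : ∃ X : ℝ, X = (2 * torusEnstrophy u₀) * F u₀ ^ (1 + σ⁻¹) := ⟨_, rfl⟩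
  obtain ⟨R, hR⟩ : ∃ R : ℝ, R = |κ| * |X| := ⟨_, rfl⟩
  have hbound : ∀ ν : ℝ, 1 ≤ ν → N u₀ + ν * V u₀ ≤ R := by
    intro ν hν1
    have hν : 0 < ν := lt_of_lt_of_le one_pos hν1
    have h := hF.initialRate_le hNV hd hν hu₀ hdiv hmean
    have hνγ : ν ^ (-γ) ≤ 1 := by
      rw [Real.rpow_neg hν.le]
      exact inv_le_one_of_one_le₀ (Real.one_le_rpow hν1 hγ)
    have hνγ0 : 0 ≤ ν ^ (-γ) := Real.rpow_nonneg hν.le _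
    calc N u₀ + ν * V u₀ ≤ κ * ν ^ (-γ) * (2 * torusEnstrophy u₀) * F u₀ ^ (1 + σ⁻¹) := h
      _ = (κ * X) * ν ^ (-γ) := by rw [hX]; ring
      _ ≤ |κ * X| * ν ^ (-γ) := mul_le_mul_of_nonneg_right (le_abs_self _) hνγ0
      _ ≤ |κ * X| * 1 := mul_le_mul_of_nonneg_left hνγ (abs_nonneg _)
      _ = R := by rw [hR, abs_mul, mul_one]
  -- choose `ν` large
  obtain ⟨ν, hν⟩ : ∃ ν : ℝ, ν = max 1 ((R - N u₀) / V u₀ + 1) := ⟨_, rfl⟩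
  have hν1 : 1 ≤ ν := by rw [hν]; exact le_max_left _ _
  have hν2 : (R - N u₀) / V u₀ + 1 ≤ ν := by rw [hν]; exact le_max_right _ _
  have h1 := hbound ν hν1
  have h2 : R - N u₀ < ν * V u₀ := by
    have h3 : (R - N u₀) / V u₀ < ν := by linarith
    have := (div_lt_iff₀ hV).1 h3
    linarith
  linarith

/-- **The heat sieve kills a row for every `κ`.** If `F` has initial rates `(N, V)` and ONE smooth
divergence-free zero-mean datum on `T³` with `V u₀ > 0` (the functional grows under pure
diffusion), then `SaturatingLaw F σ γ κ` fails for every `κ` and every `γ ≥ 0`.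
[ours; SIEVELD §1 Theorem H (N13)] -/
theorem not_saturatingLaw_of_viscousRate_pos {F : (UnitAddTorus d → EuclideanSpace ℝ d) → ℝ}
    {N V : (UnitAddTorus d → EuclideanSpace ℝ d) → ℝ} (hNV : HasInitialRate F N V)
    (hd : Fintype.card d = 3) {u₀ : UnitAddTorus d → EuclideanSpace ℝ d} (hu₀ : Torus.IsSmooth u₀)
    (hdiv : Torus.IsDivFree u₀) (hmean : Torus.HasZeroMean u₀) (hV : 0 < V u₀) {σ γ : ℝ}
    (hγ : 0 ≤ γ) (κ : ℝ) : ¬ SaturatingLaw (d := d) F σ γ κ := fun hF =>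
  absurd (hF.viscousRate_nonpos hNV hd hγ hu₀ hdiv hmean) (not_le.mpr hV)

end Summit.NavierStokesRegularity.FunctionalMining
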